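import Mathlib
import Literature.AlgebraicGeometry.HyperbolicPolynomials.HyperbolicityCone
import Summits.ValiantsHypothesis.ValiantsHypothesis.Theses.LacunarySymmetroid

/-!
# GårdingTax — hyperbolicity of the symbol is worth at most ONE letter (val-idea-21 g6, no-go theorem)

Crux BY NAME: `Summit.ValiantsHypothesis.ValiantsHypothesis.Theses.LacunarySymmetroid.MatrixDescartes`
(stmt-ValiantsHypothesis-18050, V1) and Conjecture B `KPlusLogSqLaw` (V2).  This file TYPES the
«hyperbolic shadow» of both — the statements obtained by replacing "determinant of a symmetric
`m × m` pencil `Σ_l X^{d_l} S_l`" by "restriction `h(t^{d_1},…,t^{d_K})` of a homogeneous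
GÅRDING-HYPERBOLIC form `h` of degree `k` in `K` variables" (embed-g1 autopsy, row H1 «HypB», left
OPEN there: "negation un-instrumented") — and records their NEGATIONS together with the mechanism:

* `oddCompletion n j A g = s·∏_{i=1}^{j}(s² − i²A²|y|²) + g(y)` — for EVERY form `g` of odd degree
  `2j+1` in `n` variables and all large `A` this is a hyperbolic form (direction `e_s`) whose
  restriction to the hyperplane `s = 0` is `g` (`oddCompletion_restrict`, proved;
  `oddCompletion_isHyperbolic`, paper proof in `GARDING-TAX-g6.md` §2: on each line `y' + σu` the
  `j` pairs `±iA|y'+σu|` are hyperbolas in `σ` nested around the line `σ`, the product has `2j+1`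
  alternating critical values of size `≥ μ_j (A|y|)^{2j+1}`, and `|g| ≤ ‖g‖₁|y|^{2j+1}` cannot lift
  the graph off the axis; for `j = 1` this is the cubic discriminant `27g² ≤ 4A⁶|y|⁶`).
* Consequently (`hypLacunary_lower`, Theorem B of the memo) the maximal number of positive zeros of
  a degree-`k` hyperbolic `K`-ary form on a monomial curve is squeezed between the DESCARTES numbers
  of `K−1` and `K` letters: `C(k+K−2, K−2) − 1 ≤ η_hyp(k,K) ≤ C(k+K−1, K−1) − 1` (odd `k`).
  Hyperbolicity costs one letter and nothing more.
* Hence `GardingKPlusLogSq` (= HypB) and `GardingMatrixDescartes` (= MDR with hyperbolic symbol, same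
  quantifier window `k ≤ 2^{(log₂K+c)^c}`) are FALSE (`not_gardingKPlusLogSq`,
  `not_gardingMatrixDescartes`; arithmetic in the memo §3: `k = K³`, `K ≥ 16`).

NOT to be confused with `Lines/hyperbolic.lean` (`HyperbolicLaw`/`HyperbolicB`: the UNIVARIATE
real-rooted SECTOR of the determinantal format, implied by `KPlusLogSqLaw`, open).  Nothing here
proves or refutes `MatrixDescartes`, `KPlusLogSqLaw`, `WeakLifting`; VP ≠ VNP is NOT proved.
Sorries: the four analytic/arithmetic theorems below (crux workfile; paper proofs in the memo).
-/

namespace Summit.ValiantsHypothesis.ValiantsHypothesis.Cruxes.MatrixDescartes.GardingTax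

open Literature.AlgebraicGeometry.HyperbolicPolynomials
open scoped BigOperators Polynomial

/-- Restriction of a `K`-ary polynomial to the monomial curve `t ↦ (t^{d_1}, …, t^{d_K})`. -/
noncomputable def onCurve {K : ℕ} (d : Fin K → ℕ) (f : MvPolynomial (Fin K) ℝ) : ℝ[X] :=
  MvPolynomial.aeval (fun i : Fin K => (Polynomial.X : ℝ[X]) ^ d i) f

/-- Number of distinct real roots (the count used by `MatrixDescartes`; `0` for the zero polynomial). -/
noncomputable def realRootCount (p : ℝ[X]) : ℕ := p.roots.toFinset.card

/-- Number of distinct positive roots. -/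
noncomputable def posRootCount (p : ℝ[X]) : ℕ := (p.roots.toFinset.filter fun x => 0 < x).card

theorem posRootCount_le_realRootCount (p : ℝ[X]) : posRootCount p ≤ realRootCount p :=
  Finset.card_filter_le _ _

/-- **HypB** (embed-g1 H1, typed): a `K + log² k` law for restrictions of hyperbolic forms of degree
`k` in `K` variables to monomial curves.  FALSE: `not_gardingKPlusLogSq`. -/
def GardingKPlusLogSq : Prop :=
  ∃ C : ℕ, ∀ (K k : ℕ) (f : MvPolynomial (Fin K) ℝ) (e : Fin K → ℝ) (d : Fin K → ℕ),
    f.IsHomogeneous k → IsHyperbolic f e →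
      realRootCount (onCurve d f) ≤ 2 ^ (C * (K + Nat.log 2 k ^ 2))

/-- **HypMDR**: the quantifier shape of `LacunarySymmetroid.MatrixDescartes` with the symmetric
`m × m` determinant replaced by a hyperbolic form of degree `k` (`k` in the window of `m`).
FALSE: `not_gardingMatrixDescartes`. -/
def GardingMatrixDescartes : Prop :=
  ∀ c q : ℕ, 0 < q → ∃ K₀ : ℕ, ∀ K k : ℕ, K₀ ≤ K → k ≤ 2 ^ ((Nat.log 2 K + c) ^ c) →
    ∀ (f : MvPolynomial (Fin K) ℝ) (e : Fin K → ℝ) (d : Fin K → ℕ),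
      f.IsHomogeneous k → IsHyperbolic f e →
        realRootCount (onCurve d f) ^ q ≤ 2 ^ (K * Nat.log 2 K)

/-- The **odd completion** of a form `g` in `n` variables: with `s := X (Fin.last n)` and
`|y|² := Σ_{l<n} X_l²`, `oddCompletion n j A g = s · ∏_{i=1}^{j} (s² − i² A² |y|²) + g(y)`. -/
noncomputable def oddCompletion (n j : ℕ) (A : ℝ) (g : MvPolynomial (Fin n) ℝ) :
    MvPolynomial (Fin (n + 1)) ℝ :=
  MvPolynomial.X (Fin.last n) *
      ∏ i ∈ Finset.range j,
        (MvPolynomial.X (Fin.last n) ^ 2 -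
          MvPolynomial.C (((i : ℝ) + 1) ^ 2 * A ^ 2) *
            ∑ l : Fin n, MvPolynomial.X (Fin.castSucc l) ^ 2) +
    MvPolynomial.rename Fin.castSucc g

/-- The completion restricts to `g` on the hyperplane `s = 0`. -/
theorem oddCompletion_restrict (n j : ℕ) (A : ℝ) (g : MvPolynomial (Fin n) ℝ) :
    MvPolynomial.aeval
        (Fin.lastCases (motive := fun _ => MvPolynomial (Fin n) ℝ) 0 fun l => MvPolynomial.X l)
        (oddCompletion n j A g) = g := by
  unfold oddCompletion
  rw [map_add, map_mul, MvPolynomial.aeval_X, Fin.lastCases_last, zero_mul, zero_add,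
    MvPolynomial.aeval_rename]
  have : ((Fin.lastCases (motive := fun _ => MvPolynomial (Fin n) ℝ) 0 fun l => MvPolynomial.X l) ∘
      Fin.castSucc) = fun l : Fin n => (MvPolynomial.X l : MvPolynomial (Fin n) ℝ) := by
    funext l
    simp
  rw [this, MvPolynomial.aeval_X_left, AlgHom.id_apply]

/-- The completion is homogeneous of degree `2j+1` when `g` is. -/
theorem oddCompletion_isHomogeneous (n j : ℕ) (A : ℝ) (g : MvPolynomial (Fin n) ℝ)
    (hg : g.IsHomogeneous (2 * j + 1)) : (oddCompletion n j A g).IsHomogeneous (2 * j + 1) := by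
  unfold oddCompletion
  refine MvPolynomial.IsHomogeneous.add ?_ hg.rename_isHomogeneous
  have h1 : (MvPolynomial.X (Fin.last n) : MvPolynomial (Fin (n + 1)) ℝ).IsHomogeneous 1 :=
    MvPolynomial.isHomogeneous_X ℝ _
  have h2 : ∀ i ∈ Finset.range j,
      (MvPolynomial.X (Fin.last n) ^ 2 -
          MvPolynomial.C (((i : ℝ) + 1) ^ 2 * A ^ 2) *
            ∑ l : Fin n, MvPolynomial.X (Fin.castSucc l) ^ 2 :
        MvPolynomial (Fin (n + 1)) ℝ).IsHomogeneous 2 := by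
    intro i _
    refine MvPolynomial.IsHomogeneous.sub ((MvPolynomial.isHomogeneous_X ℝ _).pow 2) ?_
    have hs : (∑ l : Fin n, MvPolynomial.X (Fin.castSucc l) ^ 2 :
        MvPolynomial (Fin (n + 1)) ℝ).IsHomogeneous 2 :=
      MvPolynomial.IsHomogeneous.sum _ _ _ fun l _ => (MvPolynomial.isHomogeneous_X ℝ _).pow 2
    have hC := (MvPolynomial.isHomogeneous_C (Fin (n + 1)) (((i : ℝ) + 1) ^ 2 * A ^ 2)).mul hs
    rwa [zero_add] at hC
  have h3 := MvPolynomial.IsHomogeneous.prod (Finset.range j) _ (fun _ => 2) h2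
  have h4 := h1.mul h3
  simp only [Finset.sum_const, Finset.card_range, smul_eq_mul] at h4
  convert h4 using 1
  ring

/-- **Completion lemma, cubic case with explicit constant.**  If `27 g(y)² ≤ 4 A⁶ |y|⁶` for all `y`
(e.g. `A³ ≥ (√27/2)‖g‖₁`), then `s³ − A²|y|² s + g(y)` is hyperbolic w.r.t. `e_s`: a depressed
cubic `s³ + p s + q` has three real roots iff `4p³ + 27q² ≤ 0`. -/
theorem oddCompletion_one_isHyperbolic (n : ℕ) (A : ℝ) (hA : 0 < A) (g : MvPolynomial (Fin n) ℝ)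
    (hg : g.IsHomogeneous 3)
    (hdisc : ∀ y : Fin n → ℝ, 27 * (MvPolynomial.eval y g) ^ 2 ≤ 4 * A ^ 6 * (∑ l, y l ^ 2) ^ 3) :
    IsHyperbolic (oddCompletion n 1 A g) (Pi.single (Fin.last n) 1) := by
  sorry

/-- **Completion lemma, general odd degree** (memo §2): every form of odd degree is the restriction
to a hyperplane of a hyperbolic form in one more variable. -/
theorem oddCompletion_isHyperbolic (n j : ℕ) (g : MvPolynomial (Fin n) ℝ)
    (hg : g.IsHomogeneous (2 * j + 1)) :
    ∃ A₀ : ℝ, ∀ A : ℝ, A₀ ≤ A → IsHyperbolic (oddCompletion n j A g) (Pi.single (Fin.last n) 1) := by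
  sorry

/-- **Theorem B (lower half): the hyperbolic tax is one letter.**  For `K ≥ 2` letters and odd
degree `k = 2j+1` there is a hyperbolic `K`-ary form with at least `C(k+K−2, K−2) − 1` (= the
sharp Descartes number of a general `(K−1)`-ary form of degree `k`) distinct POSITIVE zeros on a
monomial curve with strictly increasing exponents.  Construction (memo §3): `d_i = (k+1)^{i−1}`
(`i < K`), a `(K−1)`-ary `g` whose restriction has the maximal number of sign changes and as many
simple positive zeros, `f = Q_λ := λ^{−k}·(oddCompletion (K−1) j A g)(λ y, s)` with `λ` large
(hyperbolic for every `λ`), outer exponent `d_K` larger than `k·d_{K−1}`; simple zeros persist. -/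
theorem hypLacunary_lower (K j : ℕ) (hK : 2 ≤ K) :
    ∃ (f : MvPolynomial (Fin K) ℝ) (e : Fin K → ℝ) (d : Fin K → ℕ),
      f.IsHomogeneous (2 * j + 1) ∧ IsHyperbolic f e ∧ StrictMono d ∧
        Nat.choose (2 * j + 1 + (K - 2)) (K - 2) - 1 ≤ posRootCount (onCurve d f) := by
  sorry

/-- **Theorem B (upper half)** is Descartes' rule: `onCurve d f` has at most `C(k+K−1, K−1)`
monomials, hence at most `C(k+K−1,K−1) − 1` positive zeros — hyperbolicity is not used.  Recorded
for all `K`-ary forms of degree `k`. -/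
theorem lacunary_upper (K k : ℕ) (f : MvPolynomial (Fin K) ℝ) (hf : f.IsHomogeneous k)
    (d : Fin K → ℕ) (hf0 : onCurve d f ≠ 0) :
    posRootCount (onCurve d f) ≤ Nat.choose (k + K - 1) (K - 1) - 1 := by
  sorry

/-- Window arithmetic (pure ℕ; numerically: at `K = 16`, `K³ = 4096 ≤ 2^{343}` and
`2^{64} < C(4110, 14) − 1 ≈ 2^{131}`).  For `K ≥ 16`: `K³ ≤ 2^{(⌊log₂K⌋+3)³}` and
`2^{K⌊log₂K⌋} ≤ K^K < K^{2(K−2)} − 1 ≤ C(K³+K−2, K−2) − 1` (each of the `K−2` factors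
`(K³+i)/i` of the binomial is `≥ K²`). -/
private theorem pow_le_choose_add (a m : ℕ) :
    ∀ r : ℕ, m * r ≤ a → m ^ r ≤ Nat.choose (a + r) r
  | 0, _ => by simp
  | r + 1, h => by
    have ih := pow_le_choose_add a m r ((Nat.mul_le_mul_left m (Nat.le_succ r)).trans h)
    have key : (a + r + 1) * Nat.choose (a + r) r = Nat.choose (a + r + 1) (r + 1) * (r + 1) :=
      Nat.succ_mul_choose_eq (a + r) r
    have step : (r + 1) * m ^ (r + 1) ≤ (r + 1) * Nat.choose (a + r + 1) (r + 1) := by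
      calc (r + 1) * m ^ (r + 1) = (m * (r + 1)) * m ^ r := by ring
        _ ≤ (a + r + 1) * m ^ r := Nat.mul_le_mul_right _ (by omega)
        _ ≤ (a + r + 1) * Nat.choose (a + r) r := Nat.mul_le_mul_left _ ih
        _ = (r + 1) * Nat.choose (a + r + 1) (r + 1) := by rw [key, mul_comm]
    have := Nat.le_of_mul_le_mul_left step (Nat.succ_pos r)
    simpa [Nat.add_assoc] using this

theorem window_arith (K : ℕ) (hK : 16 ≤ K) :
    K ^ 3 ≤ 2 ^ ((Nat.log 2 K + 3) ^ 3) ∧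
      2 ^ (K * Nat.log 2 K) < Nat.choose (K ^ 3 + (K - 2)) (K - 2) - 1 := by
  set L := Nat.log 2 K with hL
  constructor
  · have h1 : K < 2 ^ (L + 1) := Nat.lt_pow_succ_log_self one_lt_two K
    have h2 : K ^ 3 ≤ (2 ^ (L + 1)) ^ 3 := Nat.pow_le_pow_left h1.le 3
    rw [← pow_mul] at h2
    have h3 : (L + 1) * 3 ≤ (L + 3) ^ 3 := by
      have h9 : 9 ≤ (L + 3) ^ 2 := by nlinarith
      calc (L + 1) * 3 ≤ (L + 3) * 9 := by omega
        _ ≤ (L + 3) * (L + 3) ^ 2 := Nat.mul_le_mul_left _ h9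
        _ = (L + 3) ^ 3 := by ring
    exact h2.trans (Nat.pow_le_pow_right two_pos h3)
  · obtain ⟨r, rfl⟩ : ∃ r, K = r + 2 := ⟨K - 2, by omega⟩
    have hr : r + 2 - 2 = r := by omega
    rw [hr]
    have hKpos : 0 < r + 2 := by omega
    -- 2^(K L) ≤ K^K
    have hA : 2 ^ ((r + 2) * L) ≤ (r + 2) ^ (r + 2) := by
      rw [mul_comm, pow_mul]
      exact Nat.pow_le_pow_left (Nat.pow_log_le_self 2 (by omega)) _
    -- K^K * K ≤ K^(2(K-2)) ≤ choose
    have hB : (r + 2) ^ (r + 2) * (r + 2) ≤ (r + 2) ^ (2 * r) := by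
      rw [← pow_succ]
      exact Nat.pow_le_pow_right hKpos (by omega)
    have hC : (r + 2) ^ (2 * r) ≤ Nat.choose ((r + 2) ^ 3 + r) r := by
      rw [pow_mul]
      exact pow_le_choose_add ((r + 2) ^ 3) ((r + 2) ^ 2) r (by nlinarith)
    have hD : (r + 2) ^ (r + 2) * 3 ≤ (r + 2) ^ (r + 2) * (r + 2) :=
      Nat.mul_le_mul_left _ (by omega)
    have hE : 1 ≤ (r + 2) ^ (r + 2) := Nat.one_le_pow _ _ hKpos
    omega

/-- `K + log²` arithmetic (pure ℕ): for every `C` some odd `K ≥ 16` has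
`2^{C (K + ⌊log₂ K³⌋²)} < C(K³+K−2, K−2) − 1` (the right side is `≥ K^{2(K−2)}`, i.e.
`2(K−2)log₂K` bits against `C·K + 9C log₂²K + O(C log K)`; take `K` odd with `log₂ K ≥ 8C`). -/
theorem kPlusLogSq_arith (C : ℕ) :
    ∃ K : ℕ, 16 ≤ K ∧ Odd K ∧
      2 ^ (C * (K + Nat.log 2 (K ^ 3) ^ 2)) < Nat.choose (K ^ 3 + (K - 2)) (K - 2) - 1 := by
  sorry

private theorem two_mul_half_add_one_of_odd {K : ℕ} (hK : Odd K) :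
    2 * ((K ^ 3 - 1) / 2) + 1 = K ^ 3 := by
  obtain ⟨r, hr⟩ := hK.pow (n := 3)
  omega

/-- **HypB is false** (from `hypLacunary_lower` + `kPlusLogSq_arith`). -/
theorem not_gardingKPlusLogSq : ¬ GardingKPlusLogSq := by
  rintro ⟨C, hC⟩
  obtain ⟨K, hK16, hodd, hbig⟩ := kPlusLogSq_arith C
  obtain ⟨f, e, d, hhom, hhyp, -, hcount⟩ := hypLacunary_lower K ((K ^ 3 - 1) / 2) (by omega)
  rw [two_mul_half_add_one_of_odd hodd] at hhom hcount
  have hle := hC K (K ^ 3) f e d hhom hhyp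
  have hpos := posRootCount_le_realRootCount (onCurve d f)
  omega

/-- **HypMDR is false** (from `hypLacunary_lower` + `window_arith`): `c = 3`, `q = 1`, `K` odd,
`K ≥ max K₀ 16`, `k = K³`. -/
theorem not_gardingMatrixDescartes : ¬ GardingMatrixDescartes := by
  intro h
  obtain ⟨K₀, hK₀⟩ := h 3 1 one_pos
  obtain ⟨hwin, hbig⟩ := window_arith (2 * (K₀ + 16) + 1) (by omega)
  have hodd : Odd (2 * (K₀ + 16) + 1) := ⟨K₀ + 16, rfl⟩
  obtain ⟨f, e, d, hhom, hhyp, -, hcount⟩ :=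
    hypLacunary_lower (2 * (K₀ + 16) + 1) (((2 * (K₀ + 16) + 1) ^ 3 - 1) / 2) (by omega)
  rw [two_mul_half_add_one_of_odd hodd] at hhom hcount
  have hle := hK₀ (2 * (K₀ + 16) + 1) ((2 * (K₀ + 16) + 1) ^ 3) (by omega) hwin f e d hhom hhyp
  rw [pow_one] at hle
  have hpos := posRootCount_le_realRootCount (onCurve d f)
  omega

/-- Sanity link: `GardingMatrixDescartes` with `q = 1` would in particular give HypB-type bounds in
the window; both fail for the same family.  (No implication between the Gårding statements and
`MatrixDescartes` is claimed in Lean: the embedding `det(sI + Σ y_l S_l)` of MDR instances into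
hyperbolic forms needs the extra letter `ε X^{e} I` and sign-changing roots — embed-g1 §0 F1.) -/
theorem gardingMatrixDescartes_shape_note : True := trivial

end Summit.ValiantsHypothesis.ValiantsHypothesis.Cruxes.MatrixDescartes.GardingTax
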